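import Summits.NavierStokesRegularity.NavierStokesRegularity.Theorems.FilamentSkeletonRssCoreLinearInvertibilityRadialBlockToolsA

/-!
# Volterra tools A for crux `CoreLinearInvertibility` (stmt-NavierStokesRegularity-17973), strategist line `Lines/even_volterra.lean`.
In the even sector of the linearisation at the asymmetric Burgers–Gaussian vortex the circular mean `W` of an even
mass-zero vorticity satisfies, in the radial variable, the divergence-form flux ODE `J = r W' + (r²/2) W + μ r² A`,
`J' = r F` (`F` = circular mean of `T_{λ,α} w`, `A` = the `cos 2θ` coefficient of the fluctuation, `μ = λ/4`,
weight `e^{βr²/4} r dr`, `β = 1 − λ ∈ (0,1]`).  The line bounds `W` by the outward Volterra reconstruction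
`P := W − W(0)e^{-r²/4}`, `P' + (r/2)P = q`, `r q = J − μ r² A`, whose weighted energy identity carries the factor `r`
in the coercive term ("Volterra gain": the strain source `μ r A` is then paired with NO weight on `A`).

This file: `ode_weighted_energy_eq` / `ode_weighted_energy_le` (the weighted energy identity / inequality for
`P' + (r/2)P`, `P(0) = 0`), `integral_mul_exp_neg_sq` (`∫₀ᵇ e^{-ar²} r = (1 − e^{-ab²})/(2a)`), and
`radial_mass_pinning` (`W = W₀e^{-r²/4} + P`, `∫₀ᵇ W r = 0`, `b ≥ 4`, `0 < β ≤ 1` ⇒ `‖W‖²_β ≤ (10/β)‖P‖²_β`).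
-/

set_option linter.dupNamespace false

noncomputable section

namespace Summit.NavierStokesRegularity.NavierStokesRegularity.Theorems

open MeasureTheory Filter Topology Set intervalIntegral

/-- **Weighted energy identity for `P' + (r/2)P = S`.** For `P ∈ C¹` and `β, b` real (`0 ≤ b`):
`e^{βb²/4} P(b)² − P(0)² + (2−β)/2 ∫₀ᵇ e^{βr²/4} P² r dr = 2 ∫₀ᵇ e^{βr²/4} P (P' + (r/2) P) dr`
(FTC for `e^{βr²/4} P²`).  With `S := P' + (r/2)P` this is the `L²(e^{βr²/4} r dr)` energy estimate of the outward
Volterra reconstruction: the coercive term carries the factor `r`. [folklore] -/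
theorem ode_weighted_energy_eq {β b : ℝ} {P P₁ : ℝ → ℝ}
    (hP : ∀ r, HasDerivAt P (P₁ r) r) (hP₁c : Continuous P₁) :
    Real.exp (β / 4 * b ^ 2) * P b ^ 2 - P 0 ^ 2 +
      (2 - β) / 2 * ∫ r in (0:ℝ)..b, Real.exp (β / 4 * r ^ 2) * P r ^ 2 * r =
      2 * ∫ r in (0:ℝ)..b, Real.exp (β / 4 * r ^ 2) * P r * (P₁ r + r / 2 * P r) := by
  have hPc : Continuous P := continuous_iff_continuousAt.2 fun r => (hP r).continuousAt
  have hEc : Continuous fun r : ℝ => Real.exp (β / 4 * r ^ 2) :=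
    Real.continuous_exp.comp (continuous_const.mul (continuous_id.pow 2))
  have hf : ∀ r ∈ uIcc 0 b, HasDerivAt (fun s => Real.exp (β / 4 * s ^ 2) * P s ^ 2)
      (2 * (β / 4) * r * Real.exp (β / 4 * r ^ 2) * P r ^ 2 +
        Real.exp (β / 4 * r ^ 2) * (2 * P r * P₁ r)) r := by
    intro r _
    have h1 := hasDerivAt_exp_mul_sq (β / 4) r
    have h2 : HasDerivAt (fun s => P s ^ 2) (2 * P r * P₁ r) r := by
      simpa using (hP r).fun_pow 2
    exact h1.mul h2
  have hc1 : Continuous fun r => 2 * (β / 4) * r * Real.exp (β / 4 * r ^ 2) * P r ^ 2 +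
      Real.exp (β / 4 * r ^ 2) * (2 * P r * P₁ r) := by
    fun_prop
  have hftc := intervalIntegral.integral_eq_sub_of_hasDerivAt hf (hc1.intervalIntegrable _ _)
  have e0 : Real.exp (β / 4 * (0:ℝ) ^ 2) * P 0 ^ 2 = P 0 ^ 2 := by simp
  have hc2 : Continuous fun r => Real.exp (β / 4 * r ^ 2) * P r ^ 2 * r := by fun_prop
  have hc3 : Continuous fun r => Real.exp (β / 4 * r ^ 2) * P r * (P₁ r + r / 2 * P r) := by fun_prop
  have key : (∫ r in (0:ℝ)..b, (2 * (β / 4) * r * Real.exp (β / 4 * r ^ 2) * P r ^ 2 +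
        Real.exp (β / 4 * r ^ 2) * (2 * P r * P₁ r))) +
      (2 - β) / 2 * ∫ r in (0:ℝ)..b, Real.exp (β / 4 * r ^ 2) * P r ^ 2 * r =
      2 * ∫ r in (0:ℝ)..b, Real.exp (β / 4 * r ^ 2) * P r * (P₁ r + r / 2 * P r) := by
    rw [← intervalIntegral.integral_const_mul, ← intervalIntegral.integral_const_mul,
      ← intervalIntegral.integral_add (hc1.intervalIntegrable _ _)
        ((hc2.intervalIntegrable _ _).const_mul _)]
    refine intervalIntegral.integral_congr fun r _ => ?_
    ring
  rw [e0] at hftc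
  linarith [hftc, key]

/-- **Energy inequality** (`P(0) = 0`, `β ≤ 2`, boundary term dropped):
`(2−β)/4 ‖P‖²_β ≤ ∫₀ᵇ e^{βr²/4} P (P' + (r/2)P) dr`. [folklore] -/
theorem ode_weighted_energy_le {β b : ℝ} {P P₁ : ℝ → ℝ}
    (hP : ∀ r, HasDerivAt P (P₁ r) r) (hP₁c : Continuous P₁) (hP0 : P 0 = 0) :
    (2 - β) / 4 * ∫ r in (0:ℝ)..b, Real.exp (β / 4 * r ^ 2) * P r ^ 2 * r ≤
      ∫ r in (0:ℝ)..b, Real.exp (β / 4 * r ^ 2) * P r * (P₁ r + r / 2 * P r) := by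
  have h := ode_weighted_energy_eq (β := β) (b := b) hP hP₁c
  rw [hP0] at h
  have hbd : 0 ≤ Real.exp (β / 4 * b ^ 2) * P b ^ 2 := by positivity
  nlinarith [h, hbd]

/-- `∫₀ᵇ e^{-a r²} r dr = (1 − e^{-a b²})/(2a)` for `a ≠ 0`. [folklore] -/
theorem integral_mul_exp_neg_sq {a b : ℝ} (ha : a ≠ 0) :
    ∫ r in (0:ℝ)..b, Real.exp (-a * r ^ 2) * r = (1 - Real.exp (-a * b ^ 2)) / (2 * a) := by
  have hderiv : ∀ r ∈ uIcc 0 b, HasDerivAt (fun s => -(1 / (2 * a)) * Real.exp (-a * s ^ 2))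
      (Real.exp (-a * r ^ 2) * r) r := by
    intro r _
    have h := (hasDerivAt_exp_mul_sq (-a) r).const_mul (-(1 / (2 * a)))
    refine h.congr_deriv ?_
    field_simp
  have hc : Continuous fun r : ℝ => Real.exp (-a * r ^ 2) * r := by fun_prop
  rw [intervalIntegral.integral_eq_sub_of_hasDerivAt hderiv (hc.intervalIntegrable _ _)]
  simp only [ne_eq, OfNat.ofNat_ne_zero, not_false_eq_true, zero_pow, mul_zero, Real.exp_zero, mul_one]
  field_simp
  ring

/-- **Mass-zero pinning of the homogeneous mode.** If `W = W₀ e^{-r²/4} + P` on `ℝ` with `P` continuous,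
`∫₀ᵇ W r dr = 0`, `b ≥ 4` and `0 < β ≤ 1`, then `‖W‖²_β ≤ (10/β) ‖P‖²_β`
(`‖g‖²_β = ∫₀ᵇ e^{βr²/4} g² r dr`): the mass condition gives `W₀ ∫₀ᵇ e^{-r²/4} r = −∫₀ᵇ P r`,
`∫₀ᵇ e^{-r²/4} r ≥ 2(1 − e^{-4}) ≥ 8/5 ≥ 1`, Cauchy–Schwarz `(∫₀ᵇ P r)² ≤ (2/β) ‖P‖²_β`, `‖e^{-r²/4}‖²_β ≤ 2`,
so `‖W‖²_β ≤ 4W₀² + 2‖P‖²_β ≤ (8/β + 2)‖P‖²_β ≤ (10/β)‖P‖²_β`. [folklore] -/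
theorem radial_mass_pinning {β b W₀ : ℝ} (hβ : 0 < β) (hβ1 : β ≤ 1) (hb : 4 ≤ b) {W P : ℝ → ℝ}
    (hPc : Continuous P) (hWP : ∀ r, W r = W₀ * Real.exp (-(r ^ 2 / 4)) + P r)
    (hmass : ∫ r in (0:ℝ)..b, W r * r = 0) :
    ∫ r in (0:ℝ)..b, Real.exp (β / 4 * r ^ 2) * W r ^ 2 * r ≤
      10 / β * ∫ r in (0:ℝ)..b, Real.exp (β / 4 * r ^ 2) * P r ^ 2 * r := by
  have hb0 : (0:ℝ) ≤ b := by linarith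
  have hβ0 : β ≠ 0 := hβ.ne'
  set NP := ∫ r in (0:ℝ)..b, Real.exp (β / 4 * r ^ 2) * P r ^ 2 * r with hNP
  have hEc : ∀ c : ℝ, Continuous fun r : ℝ => Real.exp (c * r ^ 2) := fun c =>
    Real.continuous_exp.comp (continuous_const.mul (continuous_id.pow 2))
  have hNP0 : 0 ≤ NP := intervalIntegral.integral_nonneg hb0 fun r hr => by
    have := hr.1; positivity
  -- the Gaussian mass integral `I₀ = ∫₀ᵇ e^{-r²/4} r ≥ 8/5`
  have hI₀ : ∫ r in (0:ℝ)..b, Real.exp (-(1 / 4) * r ^ 2) * r = (1 - Real.exp (-(1 / 4) * b ^ 2)) / (2 * (1 / 4)) :=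
    integral_mul_exp_neg_sq (by norm_num)
  have hI₀ge : (8:ℝ) / 5 ≤ ∫ r in (0:ℝ)..b, Real.exp (-(1 / 4) * r ^ 2) * r := by
    rw [hI₀]
    have h4 : Real.exp (-(1 / 4) * b ^ 2) ≤ Real.exp (-4) := by
      apply Real.exp_le_exp.2
      nlinarith
    have he4 : Real.exp (-4) ≤ 1 / 5 := by
      have h := Real.add_one_le_exp (4:ℝ)
      have hpos := Real.exp_pos (4:ℝ)
      rw [Real.exp_neg]
      rw [inv_le_comm₀ hpos (by norm_num)]
      linarith
    have : (1 - Real.exp (-(1 / 4) * b ^ 2)) / (2 * (1 / 4)) = 2 * (1 - Real.exp (-(1 / 4) * b ^ 2)) := by ring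
    rw [this]
    linarith
  -- mass zero: `W₀ I₀ = -∫ P r`
  have hPi : IntervalIntegrable (fun r => P r * r) volume 0 b := (hPc.mul continuous_id).intervalIntegrable _ _
  have hGi : IntervalIntegrable (fun r => W₀ * (Real.exp (-(1 / 4) * r ^ 2) * r)) volume 0 b :=
    ((hEc _).mul continuous_id).intervalIntegrable _ _ |>.const_mul _
  have hsplit : ∫ r in (0:ℝ)..b, W r * r =
      W₀ * (∫ r in (0:ℝ)..b, Real.exp (-(1 / 4) * r ^ 2) * r) + ∫ r in (0:ℝ)..b, P r * r := by
    rw [← intervalIntegral.integral_const_mul, ← intervalIntegral.integral_add hGi hPi]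
    refine intervalIntegral.integral_congr fun r _ => ?_
    simp only [hWP r]
    have : Real.exp (-(r ^ 2 / 4)) = Real.exp (-(1 / 4) * r ^ 2) := by congr 1; ring
    rw [this]; ring
  rw [hsplit] at hmass
  -- Cauchy–Schwarz: `(∫ P r)² ≤ (∫ e^{-βr²/4} r)(∫ e^{βr²/4} P² r) ≤ (2/β) NP`
  have hCS : (∫ r in (0:ℝ)..b, P r * r) ^ 2 ≤ 2 / β * NP := by
    have hf2 : IntervalIntegrable (fun r => (Real.exp (-(β / 8) * r ^ 2) * Real.sqrt r) ^ 2) volume 0 b :=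
      (((hEc _).mul Real.continuous_sqrt).pow 2).intervalIntegrable _ _
    have hg2 : IntervalIntegrable (fun r => (Real.exp (β / 8 * r ^ 2) * Real.sqrt r * P r) ^ 2) volume 0 b :=
      ((((hEc _).mul Real.continuous_sqrt).mul hPc).pow 2).intervalIntegrable _ _
    have hfg : IntervalIntegrable (fun r => (Real.exp (-(β / 8) * r ^ 2) * Real.sqrt r) *
        (Real.exp (β / 8 * r ^ 2) * Real.sqrt r * P r)) volume 0 b :=
      (((hEc _).mul Real.continuous_sqrt).mul (((hEc _).mul Real.continuous_sqrt).mul hPc)).intervalIntegrable _ _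
    have key := sq_intervalIntegral_mul_le hb0 hf2 hg2 hfg
    have e1 : ∫ r in (0:ℝ)..b, (Real.exp (-(β / 8) * r ^ 2) * Real.sqrt r) *
        (Real.exp (β / 8 * r ^ 2) * Real.sqrt r * P r) = ∫ r in (0:ℝ)..b, P r * r := by
      refine intervalIntegral.integral_congr fun r hr => ?_
      rw [uIcc_of_le hb0] at hr
      have hs : Real.sqrt r * Real.sqrt r = r := Real.mul_self_sqrt hr.1
      have hee : Real.exp (-(β / 8) * r ^ 2) * Real.exp (β / 8 * r ^ 2) = 1 := by
        rw [← Real.exp_add]; simp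
      calc Real.exp (-(β / 8) * r ^ 2) * Real.sqrt r * (Real.exp (β / 8 * r ^ 2) * Real.sqrt r * P r)
          = (Real.exp (-(β / 8) * r ^ 2) * Real.exp (β / 8 * r ^ 2)) * (Real.sqrt r * Real.sqrt r) * P r := by
            ring
        _ = P r * r := by rw [hee, hs]; ring
    have e2 : ∫ r in (0:ℝ)..b, (Real.exp (-(β / 8) * r ^ 2) * Real.sqrt r) ^ 2 =
        ∫ r in (0:ℝ)..b, Real.exp (-(β / 4) * r ^ 2) * r := by
      refine intervalIntegral.integral_congr fun r hr => ?_
      rw [uIcc_of_le hb0] at hr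
      have hs : Real.sqrt r ^ 2 = r := Real.sq_sqrt hr.1
      have hee : Real.exp (-(β / 8) * r ^ 2) ^ 2 = Real.exp (-(β / 4) * r ^ 2) := by
        rw [← Real.exp_nat_mul]; congr 1; push_cast; ring
      rw [mul_pow, hs, hee]
    have e3 : ∫ r in (0:ℝ)..b, (Real.exp (β / 8 * r ^ 2) * Real.sqrt r * P r) ^ 2 = NP := by
      rw [hNP]
      refine intervalIntegral.integral_congr fun r hr => ?_
      rw [uIcc_of_le hb0] at hr
      have hs : Real.sqrt r ^ 2 = r := Real.sq_sqrt hr.1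
      have hee : Real.exp (β / 8 * r ^ 2) ^ 2 = Real.exp (β / 4 * r ^ 2) := by
        rw [← Real.exp_nat_mul]; congr 1; push_cast; ring
      rw [mul_pow, mul_pow, hs, hee]; ring
    rw [e1, e2, e3] at key
    have hIβ : ∫ r in (0:ℝ)..b, Real.exp (-(β / 4) * r ^ 2) * r ≤ 2 / β := by
      rw [integral_mul_exp_neg_sq (by positivity : (β / 4 : ℝ) ≠ 0)]
      have hpos : 0 < Real.exp (-(β / 4) * b ^ 2) := Real.exp_pos _
      have : (1 - Real.exp (-(β / 4) * b ^ 2)) / (2 * (β / 4)) = 2 / β * (1 - Real.exp (-(β / 4) * b ^ 2)) := by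
        field_simp; ring
      rw [this]
      have h2β : 0 < 2 / β := by positivity
      nlinarith
    calc (∫ r in (0:ℝ)..b, P r * r) ^ 2
        ≤ (∫ r in (0:ℝ)..b, Real.exp (-(β / 4) * r ^ 2) * r) * NP := key
      _ ≤ 2 / β * NP := mul_le_mul_of_nonneg_right hIβ hNP0
  -- hence `W₀² ≤ (25/64)(2/β) NP`
  have hW0 : W₀ ^ 2 ≤ 2 / β * NP := by
    set I := ∫ r in (0:ℝ)..b, Real.exp (-(1 / 4) * r ^ 2) * r with hI
    have hWI : (W₀ * I) ^ 2 = (∫ r in (0:ℝ)..b, P r * r) ^ 2 := by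
      have : W₀ * I = -∫ r in (0:ℝ)..b, P r * r := by linarith
      rw [this, neg_sq]
    have h1 : W₀ ^ 2 * I ^ 2 ≤ 2 / β * NP := by rw [← mul_pow, hWI]; exact hCS
    have hI1 : 1 ≤ I ^ 2 := by nlinarith
    have h2 : 0 ≤ 2 / β * NP := by positivity
    nlinarith [sq_nonneg W₀, mul_le_mul_of_nonneg_left hI1 (sq_nonneg W₀)]
  -- `‖W‖² ≤ 2 ‖W₀ e^{-r²/4}‖² + 2 ‖P‖²` and `‖e^{-r²/4}‖²_β ≤ 2`
  have hG2 : ∫ r in (0:ℝ)..b, Real.exp (β / 4 * r ^ 2) * (W₀ * Real.exp (-(r ^ 2 / 4))) ^ 2 * r ≤ 2 * W₀ ^ 2 := by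
    have hle : ∫ r in (0:ℝ)..b, Real.exp (β / 4 * r ^ 2) * (W₀ * Real.exp (-(r ^ 2 / 4))) ^ 2 * r ≤
        ∫ r in (0:ℝ)..b, W₀ ^ 2 * (Real.exp (-(1 / 4) * r ^ 2) * r) := by
      refine intervalIntegral.integral_mono_on hb0 ?_ ?_ fun r hr => ?_
      · exact (((hEc _).mul ((continuous_const.mul (Real.continuous_exp.comp
          ((continuous_id.pow 2).div_const 4).neg)).pow 2)).mul continuous_id).intervalIntegrable _ _
      · exact (continuous_const.mul ((hEc _).mul continuous_id)).intervalIntegrable _ _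
      · have hr0 := hr.1
        have hexp : Real.exp (β / 4 * r ^ 2) * Real.exp (-(r ^ 2 / 4)) ^ 2 ≤ Real.exp (-(1 / 4) * r ^ 2) := by
          rw [← Real.exp_nat_mul, ← Real.exp_add]
          apply Real.exp_le_exp.2
          push_cast
          nlinarith [sq_nonneg r]
        calc Real.exp (β / 4 * r ^ 2) * (W₀ * Real.exp (-(r ^ 2 / 4))) ^ 2 * r
            = W₀ ^ 2 * ((Real.exp (β / 4 * r ^ 2) * Real.exp (-(r ^ 2 / 4)) ^ 2) * r) := by ring
          _ ≤ W₀ ^ 2 * (Real.exp (-(1 / 4) * r ^ 2) * r) :=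
            mul_le_mul_of_nonneg_left (mul_le_mul_of_nonneg_right hexp hr0) (sq_nonneg _)
    rw [intervalIntegral.integral_const_mul, hI₀] at hle
    have hexpb : 0 < Real.exp (-(1 / 4) * b ^ 2) := Real.exp_pos _
    have : (1 - Real.exp (-(1 / 4) * b ^ 2)) / (2 * (1 / 4)) ≤ 2 := by
      rw [div_le_iff₀ (by norm_num)]; linarith
    nlinarith [sq_nonneg W₀]
  have hsum : ∫ r in (0:ℝ)..b, Real.exp (β / 4 * r ^ 2) * W r ^ 2 * r ≤
      2 * (∫ r in (0:ℝ)..b, Real.exp (β / 4 * r ^ 2) * (W₀ * Real.exp (-(r ^ 2 / 4))) ^ 2 * r) + 2 * NP := by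
    rw [hNP, ← intervalIntegral.integral_const_mul, ← intervalIntegral.integral_const_mul,
      ← intervalIntegral.integral_add]
    · refine intervalIntegral.integral_mono_on hb0 ?_ ?_ fun r hr => ?_
      · have hWc : Continuous W := by
          have : W = fun r => W₀ * Real.exp (-(r ^ 2 / 4)) + P r := funext hWP
          rw [this]; fun_prop
        exact (((hEc _).mul (hWc.pow 2)).mul continuous_id).intervalIntegrable _ _
      · exact ((continuous_const.mul (((hEc _).mul ((continuous_const.mul (Real.continuous_exp.comp
          ((continuous_id.pow 2).div_const 4).neg)).pow 2)).mul continuous_id)).add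
          (continuous_const.mul (((hEc _).mul (hPc.pow 2)).mul continuous_id))).intervalIntegrable _ _
      · have hr0 := hr.1
        have he : 0 ≤ Real.exp (β / 4 * r ^ 2) * r := by positivity
        rw [hWP r]
        have hsq : (W₀ * Real.exp (-(r ^ 2 / 4)) + P r) ^ 2 ≤
            2 * (W₀ * Real.exp (-(r ^ 2 / 4))) ^ 2 + 2 * P r ^ 2 := by
          nlinarith [sq_nonneg (W₀ * Real.exp (-(r ^ 2 / 4)) - P r)]
        calc Real.exp (β / 4 * r ^ 2) * (W₀ * Real.exp (-(r ^ 2 / 4)) + P r) ^ 2 * r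
            = (Real.exp (β / 4 * r ^ 2) * r) * (W₀ * Real.exp (-(r ^ 2 / 4)) + P r) ^ 2 := by ring
          _ ≤ (Real.exp (β / 4 * r ^ 2) * r) * (2 * (W₀ * Real.exp (-(r ^ 2 / 4))) ^ 2 + 2 * P r ^ 2) :=
            mul_le_mul_of_nonneg_left hsq he
          _ = 2 * (Real.exp (β / 4 * r ^ 2) * (W₀ * Real.exp (-(r ^ 2 / 4))) ^ 2 * r) +
              2 * (Real.exp (β / 4 * r ^ 2) * P r ^ 2 * r) := by ring
    · exact (continuous_const.mul (((hEc _).mul ((continuous_const.mul (Real.continuous_exp.comp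
          ((continuous_id.pow 2).div_const 4).neg)).pow 2)).mul continuous_id)).intervalIntegrable _ _
    · exact (continuous_const.mul (((hEc _).mul (hPc.pow 2)).mul continuous_id)).intervalIntegrable _ _
  -- conclude: `‖W‖² ≤ 4 W₀² + 2 NP ≤ (8/β + 2) NP ≤ (10/β) NP`
  have h2β : 2 ≤ 2 / β := by
    rw [le_div_iff₀ hβ]; nlinarith
  have hNP2 : 2 * NP ≤ 2 / β * NP := by nlinarith [h2β, hNP0]
  have e10 : 4 * (2 / β * NP) + 2 / β * NP = 10 / β * NP := by ring
  show ∫ r in (0:ℝ)..b, Real.exp (β / 4 * r ^ 2) * W r ^ 2 * r ≤ 10 / β * NP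
  linarith [hsum, hG2, hW0, hNP2, e10]


end Summit.NavierStokesRegularity.NavierStokesRegularity.Theorems
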